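import Literature.MathematicalPhysics.QuantumFieldTheory.Balaban1983to89.B6BlockDecayCalculus

/-!
# `Balaban1983to89.B6BlockHolderCalculus` — T. Bałaban, *Propagators and renormalization transformations for lattice gauge theories. II*,
# Commun. Math. Phys. **96** (1984) 223–250 [Balaban1984PropagatorsII], Proposition 2.5 p. 246 with [4] = *… I*, CMP **95** (1984) Prop. 1.2
# (1.111) p. 35–36: the CALCULUS OF HÖLDER-IN-THE-OUTPUT BLOCK BOUNDS — row-sum bounds for the DIFFERENCE OF TWO ROWS of a linear map
# between `ℓ²` carriers over a pseudo-metric unit lattice (a pair of output indices = two points `x, x′` of the Hölder quotient (1.109)),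
# their composition with the plain block bounds of `…B6BlockDecayCalculus` (no volume factor), sums, the printed localized shape and the
# cut-off product rule behind `‖ζF‖_α`

statement-level skeleton of published theorems with citation tags; proofs where landed; nothing here is a claim about the Yang–Mills mass gap

PDF held: `paper:balaban1984-cmp96-propagators-rt-ii` (journal page = PDF page + 222), p. 246 [PDF 24]; `paper:balaban1984-cmp95-propagators-rt-i`
([4], journal page = PDF page + 16), pp. 35–36 [PDF 19–20] (text layers `p0024.txt`, `p0019.txt`/`p0020.txt` grepped this session).  PRINT.
[B6] p. 246 (verbatim): *"Proposition 2.5. The operator G_□ defined by (2.90) on the torus T_□ (or on the whole lattice ξZ^d) has the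
representation (2.129) and satisfies all the inequalities (1.110)–(1.114) of the Proposition 1.2 with a positive constant δ₂ instead of δ₀.
This constant depends on d and L only."*  [4] p. 35 (verbatim, as quoted in the tree's `B5.Prop12Printed`): the Hölder norm (1.109)
`‖A‖_α = max_μ sup_{x,x′: |x−x′| ≤ 1} |x − x′|^{−α}|A_μ(x) − A_μ(x′)|` and *"‖ζ∇GJ‖_α, ‖ζG∇*J‖_α ≤ O(1)e^{−δ₀|y−y′|}(‖ζ‖_α + |ζ|)|J| (1.111)
for 0 ≤ α < 1, ζ ∈ C₀^∞(Δ̃(y)), supp J ⊂ Δ̃(y′), with the constant O(1) depending on d and α (O(1) → ∞ if α → 1)"*; p. 246 of [B6]: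
*"derivatives of H′_j up to third order, and their local Hölder norms as in (2.67), are uniformly bounded and have a uniform exponential
decay"* — the paper bounds the Hölder norms of the FACTORS of (2.129) and leaves the composition to the reader.

CITATION HEADER (lean-in-tree rule) — WHAT IS REPRODUCED.  Phase-2 file of the `lit-balaban` typed skeleton (HOME `run/shared/lean/pub/lit-balaban/`),
seat **p38 gen 21** (B6 fold owner r03, referee ref-4; the (1.111) members of the Prop. 2.5 two-level decay programme of seat p22, files 1–10
`…B6Repr2129Operator` … `…B6Prop25GradDecayTwoScaleV1`, handed over by p22 gen 15), FILE H1; SKELETON row **B6.Prop2.5** (toolkit cell; decl of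
record untouched).  The calculus (all statements and proofs OURS; the papers display none of it), in the setting of p22's file 2: carriers are finite
index types `ι, κ, μ` placed over a finite pseudo-metric space `(Y, ρ)` (`…B4Sect5Torus.IsPseudoDist`, lattice sums `SumBound ρ K`), operators are
linear maps `ℓ²(κ) → ℓ²(ι)` read through their entries `f(e_k)_i`.  A HÖLDER-IN-THE-OUTPUT (pair) BOUND of `f` at the pair of output indices
`(i, i′)` with constant `C`, rate `δ` and anchor `z ∈ Y` is the hypothesis shape `∀ y, Σ_{k : pκ k = y} |f(e_k)_i − f(e_k)_{i′}| ≤ C·e^{−δρ(z, y)}`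
(no definition is introduced; in the applications `C` carries the factor `|x − x′|^α` of (1.109) and `z` is the unit site under `i`).
§1 the functional form of file 2's two shape lemmas (`abs_sum_mul_le_of_fiberBound`, **`abs_sum_mul_le_of_support`**, `fiberSum_abs_le_of_test`);
§2 `pairDiff_eq_sum` (`(fx)_i − (fx)_{i′} = Σ_k (f(e_k)_i − f(e_k)_{i′})x_k`); §3 **`holderBound_comp`**: a pair bound `(C_f, a)` of `f` and a plain
block bound `(C_g, b)` of `g` give the pair bound `(C_fC_gK(a − δ′), δ′)` of `f ∘ g` (`δ′ ≤ b`, `δ′ < a`; NO fibre-size factor — the mechanism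
«Hölder norm of the first factor × sup bounds of the others» of every (2.129)-product), `holderBound_add/sub/smul/mono`; §4 `holderBound_of_entry`
(entrywise pair bounds, fibres `≤ N`), **`holderBound_of_blockBound`** (far pairs: the triangle inequality from two row bounds, `ρ(pι i, pι i′) ≤ s`
costs `1 + e^{δs}`); §5 THE PRINTED SHAPE: **`pairDiff_le_of_support`** (pair bound ⇒ `|(fx)_i − (fx)_{i′}| ≤ C·K(1)e^{(1+2δ)r}e^{−δρ(y,y′)}X` for `x`
supported within `r` of `y′`, `|x| ≤ X`, anchor within `r` of `y`), `holderBound_of_cubeSup` (converse by sign test vectors), and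
**`abs_cutoff_pairDiff_le`**: the product rule `|ζ(x)F(x) − ζ(x′)F(x′)| ≤ |ζ(x) − ζ(x′)||F(x)| + |ζ(x′)||F(x) − F(x′)|` combining a sup bound and
a pair bound of `F = fx` with `|ζ(x) − ζ(x′)| ≤ Z_h·w`, `|ζ| ≤ Z₀` into the right side `(Z_h·w·S + Z₀·H)` of (1.111); §6 `self_le_rpow_of_le_one'`
(`t ≤ t^α` on `[0,1]` for `α ≤ 1`: a Lipschitz quotient dominates every Hölder quotient at distance `≤ 1`).  IMPORTS BY NAME (file 2's
`conv_exp_le_rate`, `card_ball_le`, `…B6SchurTorusBound.apply_eq_sum_entry`), restating nothing.  THEOREMS ONLY (no definition, no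
`def … : Prop`); standard axioms.  HONEST SCOPE: finite-dimensional bookkeeping inequalities; no operator of the papers appears in this file
(the instances — `∇∂H′_j`, `∇H_j`, `∇G^{(w′)}` and the assembly for the two-scale `G` of `tsV1` — are files H2–H4 of this seat); constants ours;
NOT summit progress.  Unit `lit-balaban-p38` (gen 21), 2026-08-22.
-/

noncomputable section

open scoped InnerProductSpace BigOperators
open Finset

namespace Literature.MathematicalPhysics.QuantumFieldTheory.Balaban1983to89.B6BlockHolderCalculus

open B4Sect5Torus (IsPseudoDist SumBound)
open B6SchurTorusBound (apply_eq_sum_entry)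
open B6BlockDecayCalculus (conv_exp_le_rate card_ball_le)

section Abstract

variable {Y : Type*} {ρ : Y → Y → ℝ} {KY : ℝ → ℝ}
variable {ι κ μ : Type} [Fintype κ]

/-! ## §1  Functionals `x ↦ Σ_k φ(k)x_k` with a fibrewise summable profile: the shape lemmas of file 2 in functional form -/

/-- **pointwise bound of `Σ_k φ(k)x_k`** from a fibrewise bound `Σ_{k : pκ k = y}|φ(k)| ≤ Ce^{−δρ(z, y)}` and a block profile `|x_k| ≤ g(pκ k)`,
`g ≥ 0`: `|Σ_k φ(k)x_k| ≤ C·Σ_y e^{−δρ(z, y)}g(y)` (file 2's `abs_apply_le_of_blockBound` for a row `φ = f(e_·)_i`; here `φ` is any coefficient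
vector, e.g. the difference of two rows). [cite: Balaban1984PropagatorsI, (1.111) p.35 (bookkeeping, ours)] -/
theorem abs_sum_mul_le_of_fiberBound [Fintype Y] [DecidableEq Y] (φ : κ → ℝ) (pκ : κ → Y) (z : Y) {C δ : ℝ}
    (hφ : ∀ y : Y, ∑ k ∈ univ.filter (fun k => pκ k = y), |φ k| ≤ C * Real.exp (-(δ * ρ z y)))
    (x : EuclideanSpace ℝ κ) (g : Y → ℝ) (hg : ∀ y, 0 ≤ g y) (hx : ∀ k, |x k| ≤ g (pκ k)) :
    |∑ k, φ k * x k| ≤ C * ∑ y, Real.exp (-(δ * ρ z y)) * g y := by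
  calc |∑ k, φ k * x k| ≤ ∑ k, |φ k * x k| := Finset.abs_sum_le_sum_abs _ _
    _ = ∑ k, |φ k| * |x k| := Finset.sum_congr rfl fun k _ => abs_mul _ _
    _ ≤ ∑ k, |φ k| * g (pκ k) := Finset.sum_le_sum fun k _ => mul_le_mul_of_nonneg_left (hx k) (abs_nonneg _)
    _ = ∑ y, ∑ k ∈ univ.filter (fun k => pκ k = y), |φ k| * g (pκ k) := (Finset.sum_fiberwise univ pκ _).symm
    _ = ∑ y, (∑ k ∈ univ.filter (fun k => pκ k = y), |φ k|) * g y := by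
        refine Finset.sum_congr rfl fun y _ => ?_
        rw [Finset.sum_mul]
        refine Finset.sum_congr rfl fun k hk => ?_
        rw [(Finset.mem_filter.mp hk).2]
    _ ≤ ∑ y, C * Real.exp (-(δ * ρ z y)) * g y := Finset.sum_le_sum fun y _ => mul_le_mul_of_nonneg_right (hφ y) (hg y)
    _ = C * ∑ y, Real.exp (-(δ * ρ z y)) * g y := by
        rw [Finset.mul_sum]
        exact Finset.sum_congr rfl fun y _ => by ring

/-- **THE LOCALIZED SHAPE, functional form**: if `Σ_{k : pκ k = y}|φ(k)| ≤ Ce^{−δρ(z, y)}` (`C, δ ≥ 0`), `x` is supported over the points within `r` of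
`y′`, `|x_k| ≤ X`, and the anchor `z` is within `r` of `y`, then `|Σ_k φ(k)x_k| ≤ C·K(1)e^{(1+2δ)r}·e^{−δρ(y,y′)}·X` (file 2's `abs_apply_le_of_support`
with the anchor in place of the position of the output index). [cite: Balaban1984PropagatorsI, (1.111) p.35 (shape; derivation ours)] -/
theorem abs_sum_mul_le_of_support [Fintype Y] [DecidableEq Y] (hρ : IsPseudoDist ρ) (hK : SumBound ρ KY) (φ : κ → ℝ) (pκ : κ → Y) (z : Y)
    {C δ r X : ℝ} (hC : 0 ≤ C) (hδ : 0 ≤ δ) (hX : 0 ≤ X)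
    (hφ : ∀ y : Y, ∑ k ∈ univ.filter (fun k => pκ k = y), |φ k| ≤ C * Real.exp (-(δ * ρ z y)))
    (x : EuclideanSpace ℝ κ) (y y' : Y) (hsupp : ∀ k, x k ≠ 0 → ρ (pκ k) y' ≤ r) (hx : ∀ k, |x k| ≤ X) (hz : ρ z y ≤ r) :
    |∑ k, φ k * x k| ≤ C * (KY 1 * Real.exp ((1 + 2 * δ) * r)) * Real.exp (-(δ * ρ y y')) * X := by
  -- block profile of `x`: `X` on the `r`-ball of `y′`, `0` elsewhere
  set g : Y → ℝ := fun t => if ρ t y' ≤ r then X else 0 with hg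
  have hg0 : ∀ t, 0 ≤ g t := fun t => by
    simp only [hg]
    split_ifs
    · exact hX
    · exact le_rfl
  have hxg : ∀ k, |x k| ≤ g (pκ k) := fun k => by
    by_cases hk : x k = 0
    · rw [hk, abs_zero]; exact hg0 _
    · simp only [hg, if_pos (hsupp k hk)]; exact hx k
  have h1 := abs_sum_mul_le_of_fiberBound φ pκ z hφ x g hg0 hxg
  -- `e^{−δρ(z, t)} ≤ e^{2δr}e^{−δρ(y,y′)}` on the ball
  have hball : ∀ t, ρ t y' ≤ r → Real.exp (-(δ * ρ z t)) ≤ Real.exp (2 * δ * r) * Real.exp (-(δ * ρ y y')) := by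
    intro t ht
    rw [← Real.exp_add]
    apply Real.exp_le_exp.2
    have t1 := hρ.triangle y z y'
    have t2 := hρ.triangle z t y'
    rw [hρ.symm y z] at t1
    nlinarith [mul_le_mul_of_nonneg_left t1 hδ, mul_le_mul_of_nonneg_left t2 hδ]
  have h2 : ∑ t, Real.exp (-(δ * ρ z t)) * g t ≤
      ∑ t ∈ univ.filter (fun t => ρ t y' ≤ r), Real.exp (2 * δ * r) * Real.exp (-(δ * ρ y y')) * X := by
    rw [← Finset.sum_filter_add_sum_filter_not univ (fun t => ρ t y' ≤ r)]
    have hz' : ∑ t ∈ univ.filter (fun t => ¬ ρ t y' ≤ r), Real.exp (-(δ * ρ z t)) * g t = 0 :=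
      Finset.sum_eq_zero fun t ht => by simp only [hg, if_neg (Finset.mem_filter.mp ht).2, mul_zero]
    rw [hz', add_zero]
    refine Finset.sum_le_sum fun t ht => ?_
    have ht' : ρ t y' ≤ r := (Finset.mem_filter.mp ht).2
    simp only [hg, if_pos ht']
    exact mul_le_mul_of_nonneg_right (hball t ht') hX
  have h3 : ∑ t ∈ univ.filter (fun t => ρ t y' ≤ r), Real.exp (2 * δ * r) * Real.exp (-(δ * ρ y y')) * X ≤
      Real.exp r * KY 1 * (Real.exp (2 * δ * r) * Real.exp (-(δ * ρ y y')) * X) := by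
    rw [Finset.sum_const, nsmul_eq_mul]
    exact mul_le_mul_of_nonneg_right (card_ball_le hρ hK y' r) (by positivity)
  calc |∑ k, φ k * x k| ≤ C * ∑ t, Real.exp (-(δ * ρ z t)) * g t := h1
    _ ≤ C * (Real.exp r * KY 1 * (Real.exp (2 * δ * r) * Real.exp (-(δ * ρ y y')) * X)) := mul_le_mul_of_nonneg_left (h2.trans h3) hC
    _ = C * (KY 1 * Real.exp ((1 + 2 * δ) * r)) * Real.exp (-(δ * ρ y y')) * X := by
        have : Real.exp ((1 + 2 * δ) * r) = Real.exp r * Real.exp (2 * δ * r) := by rw [← Real.exp_add]; ring_nf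
        rw [this]; ring

/-- **TEST VECTORS**: if `|Σ_k φ(k)x_k| ≤ B` for every `x` supported in the fibre of `y′` with `|x_k| ≤ 1`, then `Σ_{k : pκ k = y′}|φ(k)| ≤ B` (test on
the sign vector of `φ` restricted to the fibre). [cite: Balaban1984PropagatorsI, (1.111) p.35 (shape; derivation ours)] -/
theorem fiberSum_abs_le_of_test [DecidableEq Y] (φ : κ → ℝ) (pκ : κ → Y) (y' : Y) {B : ℝ}
    (h : ∀ x : EuclideanSpace ℝ κ, (∀ k, x k ≠ 0 → pκ k = y') → (∀ k, |x k| ≤ 1) → |∑ k, φ k * x k| ≤ B) :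
    ∑ k ∈ univ.filter (fun k => pκ k = y'), |φ k| ≤ B := by
  set x : EuclideanSpace ℝ κ := WithLp.toLp 2 (fun k => if pκ k = y' then (if 0 ≤ φ k then (1 : ℝ) else -1) else 0) with hxdef
  have hxk : ∀ k, x k = if pκ k = y' then (if 0 ≤ φ k then (1 : ℝ) else -1) else 0 := fun k => rfl
  have hsupp : ∀ k, x k ≠ 0 → pκ k = y' := by
    intro k hk
    rw [hxk] at hk
    by_contra hk'
    exact hk (if_neg hk')
  have hX : ∀ k, |x k| ≤ 1 := fun k => by
    rw [hxk]; split_ifs <;> simp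
  have hsum : ∑ k, φ k * x k = ∑ k ∈ univ.filter (fun k => pκ k = y'), |φ k| := by
    rw [← Finset.sum_filter_add_sum_filter_not univ (fun k => pκ k = y')]
    have hz : ∑ k ∈ univ.filter (fun k => ¬ pκ k = y'), φ k * x k = 0 :=
      Finset.sum_eq_zero fun k hk => by rw [hxk, if_neg (Finset.mem_filter.mp hk).2, mul_zero]
    rw [hz, add_zero]
    refine Finset.sum_congr rfl fun k hk => ?_
    rw [hxk, if_pos (Finset.mem_filter.mp hk).2]
    split_ifs with hs
    · rw [mul_one, abs_of_nonneg hs]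
    · rw [mul_neg, mul_one, abs_of_neg (lt_of_not_ge hs)]
  have key := h x hsupp hX
  rw [hsum] at key
  have habs : abs (∑ k ∈ univ.filter (fun k => pκ k = y'), |φ k|) = ∑ k ∈ univ.filter (fun k => pκ k = y'), |φ k| :=
    abs_of_nonneg (Finset.sum_nonneg fun _ _ => abs_nonneg _)
  rwa [habs] at key

/-! ## §2  The difference of two rows -/

variable [DecidableEq κ]

/-- **`(fx)_i − (fx)_{i′} = Σ_k (f(e_k)_i − f(e_k)_{i′})·x_k`**: the Hölder quotient of `fx` at the output pair `(i, i′)` is the functional with the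
coefficient vector «row `i` minus row `i′`». [cite: Balaban1984PropagatorsI, (1.109) p.35 (bookkeeping, ours)] -/
theorem pairDiff_eq_sum (f : EuclideanSpace ℝ κ →ₗ[ℝ] EuclideanSpace ℝ ι) (x : EuclideanSpace ℝ κ) (i i' : ι) :
    f x i - f x i' = ∑ k, (f (EuclideanSpace.single k (1 : ℝ)) i - f (EuclideanSpace.single k (1 : ℝ)) i') * x k := by
  rw [apply_eq_sum_entry f x i, apply_eq_sum_entry f x i', ← Finset.sum_sub_distrib]
  exact Finset.sum_congr rfl fun k _ => by ring

/-- `|(fx)_i − (fx)_{i′}| ≤ Σ_k |f(e_k)_i − f(e_k)_{i′}|·|x_k|`. [cite: Balaban1984PropagatorsI, (1.109) p.35 (bookkeeping, ours)] -/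
theorem abs_pairDiff_le_sum (f : EuclideanSpace ℝ κ →ₗ[ℝ] EuclideanSpace ℝ ι) (x : EuclideanSpace ℝ κ) (i i' : ι) :
    |f x i - f x i'| ≤ ∑ k, |f (EuclideanSpace.single k (1 : ℝ)) i - f (EuclideanSpace.single k (1 : ℝ)) i'| * |x k| := by
  rw [pairDiff_eq_sum]
  exact (Finset.abs_sum_le_sum_abs _ _).trans (le_of_eq (Finset.sum_congr rfl fun k _ => abs_mul _ _))

/-! ## §3  Composition with block bounds; sums; scalars; monotonicity -/

/-- **COMPOSITION — HÖLDER NORM OF THE FIRST FACTOR TIMES SUP BOUNDS OF THE OTHERS, NO VOLUME FACTOR**: a pair bound `(C_f, a)` of `f : ℓ²(κ) → ℓ²(ι)`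
at `(i, i′)` anchored at `z` and a block bound `(C_g, b)` of `g : ℓ²(μ) → ℓ²(κ)` give the pair bound `(C_f·C_g·K(a − δ′), δ′)` of `f ∘ g` at
`(i, i′)` anchored at `z`, for every `0 ≤ δ′ ≤ b`, `δ′ < a` (file 2's `blockBound_comp` for the difference of two rows; the fibre sizes of the
middle carrier do not enter). [cite: Balaban1984PropagatorsII, Prop. 2.5 p.246 (the undisplayed «(2.129) ⇒ (1.111)» composition step; statement and proof ours)] -/
theorem holderBound_comp [Fintype Y] [DecidableEq Y] [Fintype μ] [DecidableEq μ] (hρ : IsPseudoDist ρ) (hK : SumBound ρ KY)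
    (f : EuclideanSpace ℝ κ →ₗ[ℝ] EuclideanSpace ℝ ι) (g : EuclideanSpace ℝ μ →ₗ[ℝ] EuclideanSpace ℝ κ) (pκ : κ → Y) (pμ : μ → Y)
    (i i' : ι) (z : Y) {Cf Cg a b δ' : ℝ} (hCf : 0 ≤ Cf) (hCg : 0 ≤ Cg) (hδ'0 : 0 ≤ δ') (hδ'b : δ' ≤ b) (hδ'a : δ' < a)
    (hf : ∀ y : Y, ∑ k ∈ univ.filter (fun k => pκ k = y),
      |f (EuclideanSpace.single k (1 : ℝ)) i - f (EuclideanSpace.single k (1 : ℝ)) i'| ≤ Cf * Real.exp (-(a * ρ z y)))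
    (hg : ∀ (k : κ) (y : Y), ∑ m ∈ univ.filter (fun m => pμ m = y), |g (EuclideanSpace.single m (1 : ℝ)) k| ≤ Cg * Real.exp (-(b * ρ (pκ k) y)))
    (y : Y) :
    ∑ m ∈ univ.filter (fun m => pμ m = y),
        |(f ∘ₗ g) (EuclideanSpace.single m (1 : ℝ)) i - (f ∘ₗ g) (EuclideanSpace.single m (1 : ℝ)) i'| ≤
      Cf * Cg * KY (a - δ') * Real.exp (-(δ' * ρ z y)) := by
  -- Σ_{m∈y} |(fg)_{im} − (fg)_{i′m}| ≤ Σ_k |f_{ik} − f_{i′k}| Σ_{m∈y} |g_{km}|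
  have h1 : ∑ m ∈ univ.filter (fun m => pμ m = y),
      |(f ∘ₗ g) (EuclideanSpace.single m (1 : ℝ)) i - (f ∘ₗ g) (EuclideanSpace.single m (1 : ℝ)) i'| ≤
      ∑ k, |f (EuclideanSpace.single k (1 : ℝ)) i - f (EuclideanSpace.single k (1 : ℝ)) i'| *
        ∑ m ∈ univ.filter (fun m => pμ m = y), |g (EuclideanSpace.single m (1 : ℝ)) k| := by
    calc ∑ m ∈ univ.filter (fun m => pμ m = y),
          |(f ∘ₗ g) (EuclideanSpace.single m (1 : ℝ)) i - (f ∘ₗ g) (EuclideanSpace.single m (1 : ℝ)) i'|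
        ≤ ∑ m ∈ univ.filter (fun m => pμ m = y), ∑ k, |f (EuclideanSpace.single k (1 : ℝ)) i - f (EuclideanSpace.single k (1 : ℝ)) i'| *
            |g (EuclideanSpace.single m (1 : ℝ)) k| :=
          Finset.sum_le_sum fun m _ => by
            rw [LinearMap.comp_apply]
            exact abs_pairDiff_le_sum f _ i i'
      _ = _ := by rw [Finset.sum_comm]; exact Finset.sum_congr rfl fun k _ => by rw [Finset.mul_sum]
  have h2 : ∑ k, |f (EuclideanSpace.single k (1 : ℝ)) i - f (EuclideanSpace.single k (1 : ℝ)) i'| *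
        ∑ m ∈ univ.filter (fun m => pμ m = y), |g (EuclideanSpace.single m (1 : ℝ)) k| ≤
      ∑ k, |f (EuclideanSpace.single k (1 : ℝ)) i - f (EuclideanSpace.single k (1 : ℝ)) i'| * (Cg * Real.exp (-(b * ρ (pκ k) y))) :=
    Finset.sum_le_sum fun k _ => mul_le_mul_of_nonneg_left (hg k y) (abs_nonneg _)
  have h3 : ∑ k, |f (EuclideanSpace.single k (1 : ℝ)) i - f (EuclideanSpace.single k (1 : ℝ)) i'| * (Cg * Real.exp (-(b * ρ (pκ k) y))) =
      ∑ y', (∑ k ∈ univ.filter (fun k => pκ k = y'), |f (EuclideanSpace.single k (1 : ℝ)) i - f (EuclideanSpace.single k (1 : ℝ)) i'|) *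
        (Cg * Real.exp (-(b * ρ y' y))) := by
    rw [← Finset.sum_fiberwise univ pκ (fun k => |f (EuclideanSpace.single k (1 : ℝ)) i - f (EuclideanSpace.single k (1 : ℝ)) i'| *
      (Cg * Real.exp (-(b * ρ (pκ k) y))))]
    refine Finset.sum_congr rfl fun y' _ => ?_
    rw [Finset.sum_mul]
    refine Finset.sum_congr rfl fun k hk => ?_
    rw [(Finset.mem_filter.mp hk).2]
  have h4 : ∑ y', (∑ k ∈ univ.filter (fun k => pκ k = y'), |f (EuclideanSpace.single k (1 : ℝ)) i - f (EuclideanSpace.single k (1 : ℝ)) i'|) *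
        (Cg * Real.exp (-(b * ρ y' y))) ≤
      ∑ y', Cf * Real.exp (-(a * ρ z y')) * (Cg * Real.exp (-(b * ρ y' y))) :=
    Finset.sum_le_sum fun y' _ => mul_le_mul_of_nonneg_right (hf y') (by positivity)
  have h5 : ∑ y', Cf * Real.exp (-(a * ρ z y')) * (Cg * Real.exp (-(b * ρ y' y))) =
      Cf * Cg * ∑ y', Real.exp (-(a * ρ z y')) * Real.exp (-(b * ρ y' y)) := by
    rw [Finset.mul_sum]; exact Finset.sum_congr rfl fun y' _ => by ring
  have h6 := conv_exp_le_rate hρ hK hδ'0 hδ'b hδ'a z y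
  calc _ ≤ _ := h1
    _ ≤ _ := h2
    _ = _ := h3
    _ ≤ _ := h4
    _ = _ := h5
    _ ≤ Cf * Cg * (KY (a - δ') * Real.exp (-(δ' * ρ z y))) := mul_le_mul_of_nonneg_left h6 (mul_nonneg hCf hCg)
    _ = _ := by ring

/-- pair bounds ADD: `(C_f, δ)` and `(C_g, δ)` at the same pair and anchor give `(C_f + C_g, δ)` for `f + g`.
[cite: Balaban1984PropagatorsII, Prop. 2.5 p.246 (composition bookkeeping, ours)] -/
theorem holderBound_add [DecidableEq Y] (f g : EuclideanSpace ℝ κ →ₗ[ℝ] EuclideanSpace ℝ ι) (pκ : κ → Y) (i i' : ι) (z : Y) {Cf Cg δ : ℝ}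
    (hf : ∀ y : Y, ∑ k ∈ univ.filter (fun k => pκ k = y),
      |f (EuclideanSpace.single k (1 : ℝ)) i - f (EuclideanSpace.single k (1 : ℝ)) i'| ≤ Cf * Real.exp (-(δ * ρ z y)))
    (hg : ∀ y : Y, ∑ k ∈ univ.filter (fun k => pκ k = y),
      |g (EuclideanSpace.single k (1 : ℝ)) i - g (EuclideanSpace.single k (1 : ℝ)) i'| ≤ Cg * Real.exp (-(δ * ρ z y)))
    (y : Y) :
    ∑ k ∈ univ.filter (fun k => pκ k = y),
        |(f + g) (EuclideanSpace.single k (1 : ℝ)) i - (f + g) (EuclideanSpace.single k (1 : ℝ)) i'| ≤ (Cf + Cg) * Real.exp (-(δ * ρ z y)) := by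
  calc ∑ k ∈ univ.filter (fun k => pκ k = y),
        |(f + g) (EuclideanSpace.single k (1 : ℝ)) i - (f + g) (EuclideanSpace.single k (1 : ℝ)) i'|
      ≤ ∑ k ∈ univ.filter (fun k => pκ k = y), (|f (EuclideanSpace.single k (1 : ℝ)) i - f (EuclideanSpace.single k (1 : ℝ)) i'| +
          |g (EuclideanSpace.single k (1 : ℝ)) i - g (EuclideanSpace.single k (1 : ℝ)) i'|) :=
        Finset.sum_le_sum fun k _ => by
          rw [LinearMap.add_apply, PiLp.add_apply, PiLp.add_apply]
          calc _ = |(f (EuclideanSpace.single k (1 : ℝ)) i - f (EuclideanSpace.single k (1 : ℝ)) i') +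
                (g (EuclideanSpace.single k (1 : ℝ)) i - g (EuclideanSpace.single k (1 : ℝ)) i')| := by ring_nf
            _ ≤ _ := abs_add_le _ _
    _ ≤ _ := by rw [Finset.sum_add_distrib, add_mul]; exact add_le_add (hf y) (hg y)

/-- pair bounds SUBTRACT: `(C_f + C_g, δ)` for `f − g`. [cite: Balaban1984PropagatorsII, Prop. 2.5 p.246 (composition bookkeeping, ours)] -/
theorem holderBound_sub [DecidableEq Y] (f g : EuclideanSpace ℝ κ →ₗ[ℝ] EuclideanSpace ℝ ι) (pκ : κ → Y) (i i' : ι) (z : Y) {Cf Cg δ : ℝ}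
    (hf : ∀ y : Y, ∑ k ∈ univ.filter (fun k => pκ k = y),
      |f (EuclideanSpace.single k (1 : ℝ)) i - f (EuclideanSpace.single k (1 : ℝ)) i'| ≤ Cf * Real.exp (-(δ * ρ z y)))
    (hg : ∀ y : Y, ∑ k ∈ univ.filter (fun k => pκ k = y),
      |g (EuclideanSpace.single k (1 : ℝ)) i - g (EuclideanSpace.single k (1 : ℝ)) i'| ≤ Cg * Real.exp (-(δ * ρ z y)))
    (y : Y) :
    ∑ k ∈ univ.filter (fun k => pκ k = y),
        |(f - g) (EuclideanSpace.single k (1 : ℝ)) i - (f - g) (EuclideanSpace.single k (1 : ℝ)) i'| ≤ (Cf + Cg) * Real.exp (-(δ * ρ z y)) := by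
  calc ∑ k ∈ univ.filter (fun k => pκ k = y),
        |(f - g) (EuclideanSpace.single k (1 : ℝ)) i - (f - g) (EuclideanSpace.single k (1 : ℝ)) i'|
      ≤ ∑ k ∈ univ.filter (fun k => pκ k = y), (|f (EuclideanSpace.single k (1 : ℝ)) i - f (EuclideanSpace.single k (1 : ℝ)) i'| +
          |g (EuclideanSpace.single k (1 : ℝ)) i - g (EuclideanSpace.single k (1 : ℝ)) i'|) :=
        Finset.sum_le_sum fun k _ => by
          rw [LinearMap.sub_apply, PiLp.sub_apply, PiLp.sub_apply]
          calc _ = |(f (EuclideanSpace.single k (1 : ℝ)) i - f (EuclideanSpace.single k (1 : ℝ)) i') -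
                (g (EuclideanSpace.single k (1 : ℝ)) i - g (EuclideanSpace.single k (1 : ℝ)) i')| := by ring_nf
            _ ≤ _ := abs_sub _ _
    _ ≤ _ := by rw [Finset.sum_add_distrib, add_mul]; exact add_le_add (hf y) (hg y)

/-- pair bounds SCALE: `(|c|·C_f, δ)` for `c·f`. [cite: Balaban1984PropagatorsII, Prop. 2.5 p.246 (composition bookkeeping, ours)] -/
theorem holderBound_smul [DecidableEq Y] (f : EuclideanSpace ℝ κ →ₗ[ℝ] EuclideanSpace ℝ ι) (pκ : κ → Y) (i i' : ι) (z : Y) {Cf δ : ℝ} (c : ℝ)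
    (hf : ∀ y : Y, ∑ k ∈ univ.filter (fun k => pκ k = y),
      |f (EuclideanSpace.single k (1 : ℝ)) i - f (EuclideanSpace.single k (1 : ℝ)) i'| ≤ Cf * Real.exp (-(δ * ρ z y)))
    (y : Y) :
    ∑ k ∈ univ.filter (fun k => pκ k = y),
        |(c • f) (EuclideanSpace.single k (1 : ℝ)) i - (c • f) (EuclideanSpace.single k (1 : ℝ)) i'| ≤ |c| * Cf * Real.exp (-(δ * ρ z y)) := by
  calc ∑ k ∈ univ.filter (fun k => pκ k = y),
        |(c • f) (EuclideanSpace.single k (1 : ℝ)) i - (c • f) (EuclideanSpace.single k (1 : ℝ)) i'|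
      = |c| * ∑ k ∈ univ.filter (fun k => pκ k = y), |f (EuclideanSpace.single k (1 : ℝ)) i - f (EuclideanSpace.single k (1 : ℝ)) i'| := by
        rw [Finset.mul_sum]
        refine Finset.sum_congr rfl fun k _ => ?_
        rw [LinearMap.smul_apply, PiLp.smul_apply, PiLp.smul_apply, smul_eq_mul, smul_eq_mul, ← mul_sub, abs_mul]
    _ ≤ |c| * (Cf * Real.exp (-(δ * ρ z y))) := mul_le_mul_of_nonneg_left (hf y) (abs_nonneg c)
    _ = _ := by ring

/-- pair bounds are MONOTONE in the constant and ANTITONE in the rate. [cite: Balaban1984PropagatorsII, Prop. 2.5 p.246 (composition bookkeeping, ours)] -/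
theorem holderBound_mono [DecidableEq Y] (hρ : IsPseudoDist ρ) (f : EuclideanSpace ℝ κ →ₗ[ℝ] EuclideanSpace ℝ ι) (pκ : κ → Y) (i i' : ι) (z : Y)
    {C C' δ δ' : ℝ} (hC' : 0 ≤ C') (hCC : C ≤ C') (hδδ : δ' ≤ δ)
    (hf : ∀ y : Y, ∑ k ∈ univ.filter (fun k => pκ k = y),
      |f (EuclideanSpace.single k (1 : ℝ)) i - f (EuclideanSpace.single k (1 : ℝ)) i'| ≤ C * Real.exp (-(δ * ρ z y)))
    (y : Y) :
    ∑ k ∈ univ.filter (fun k => pκ k = y),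
        |f (EuclideanSpace.single k (1 : ℝ)) i - f (EuclideanSpace.single k (1 : ℝ)) i'| ≤ C' * Real.exp (-(δ' * ρ z y)) := by
  refine (hf y).trans ?_
  have h1 : Real.exp (-(δ * ρ z y)) ≤ Real.exp (-(δ' * ρ z y)) := Real.exp_le_exp.2 (by nlinarith [hρ.nonneg z y])
  exact (mul_le_mul_of_nonneg_right hCC (Real.exp_pos _).le).trans (mul_le_mul_of_nonneg_left h1 hC')

/-! ## §4  Pair bounds from entrywise bounds, and from two row bounds (far pairs) -/

/-- **entrywise pair bounds ⇒ pair bound**: `|f(e_k)_i − f(e_k)_{i′}| ≤ Ae^{−δρ(z, pκ k)}` and fibres of `pκ` of size `≤ N` give `(A·N, δ)`.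
[cite: Balaban1984PropagatorsII, Prop. 2.5 p.246 (composition bookkeeping, ours)] -/
theorem holderBound_of_entry [DecidableEq Y] (f : EuclideanSpace ℝ κ →ₗ[ℝ] EuclideanSpace ℝ ι) (pκ : κ → Y) (i i' : ι) (z : Y) {A δ : ℝ} {N : ℕ}
    (hA : 0 ≤ A) (hN : ∀ y, (univ.filter fun k => pκ k = y).card ≤ N)
    (hf : ∀ k : κ, |f (EuclideanSpace.single k (1 : ℝ)) i - f (EuclideanSpace.single k (1 : ℝ)) i'| ≤ A * Real.exp (-(δ * ρ z (pκ k)))) (y : Y) :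
    ∑ k ∈ univ.filter (fun k => pκ k = y),
        |f (EuclideanSpace.single k (1 : ℝ)) i - f (EuclideanSpace.single k (1 : ℝ)) i'| ≤ A * N * Real.exp (-(δ * ρ z y)) := by
  calc ∑ k ∈ univ.filter (fun k => pκ k = y), |f (EuclideanSpace.single k (1 : ℝ)) i - f (EuclideanSpace.single k (1 : ℝ)) i'|
      ≤ ∑ k ∈ univ.filter (fun k => pκ k = y), A * Real.exp (-(δ * ρ z y)) :=
        Finset.sum_le_sum fun k hk => by rw [← (Finset.mem_filter.mp hk).2]; exact hf k
    _ = (univ.filter fun k => pκ k = y).card * (A * Real.exp (-(δ * ρ z y))) := by rw [Finset.sum_const, nsmul_eq_mul]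
    _ ≤ N * (A * Real.exp (-(δ * ρ z y))) := mul_le_mul_of_nonneg_right (by exact_mod_cast hN y) (by positivity)
    _ = _ := by ring

/-- **FAR PAIRS — the triangle inequality from two row bounds**: if `f` has the block bound `(C, δ)` (`C, δ ≥ 0`) and the output positions of
`i, i′` are within `s` of each other, then at `(i, i′)`, anchored at `pι i`, `f` has the pair bound `(C(1 + e^{δs}), δ)` — used for the pairs
`x, x′` of (1.109) at distance bounded below, where `|x − x′|^{−α}` is bounded. [cite: Balaban1984PropagatorsI, (1.111) p.35 (bookkeeping, ours)] -/
theorem holderBound_of_blockBound [DecidableEq Y] (hρ : IsPseudoDist ρ) (f : EuclideanSpace ℝ κ →ₗ[ℝ] EuclideanSpace ℝ ι) (pι : ι → Y) (pκ : κ → Y)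
    (i i' : ι) {C δ s : ℝ} (hC : 0 ≤ C) (hδ : 0 ≤ δ) (hs : ρ (pι i) (pι i') ≤ s)
    (hf : ∀ (i : ι) (y : Y), ∑ k ∈ univ.filter (fun k => pκ k = y), |f (EuclideanSpace.single k (1 : ℝ)) i| ≤ C * Real.exp (-(δ * ρ (pι i) y)))
    (y : Y) :
    ∑ k ∈ univ.filter (fun k => pκ k = y),
        |f (EuclideanSpace.single k (1 : ℝ)) i - f (EuclideanSpace.single k (1 : ℝ)) i'| ≤ C * (1 + Real.exp (δ * s)) * Real.exp (-(δ * ρ (pι i) y)) := by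
  have hshift : Real.exp (-(δ * ρ (pι i') y)) ≤ Real.exp (δ * s) * Real.exp (-(δ * ρ (pι i) y)) := by
    rw [← Real.exp_add]
    apply Real.exp_le_exp.2
    have t := hρ.triangle (pι i) (pι i') y
    nlinarith [mul_le_mul_of_nonneg_left t hδ, mul_le_mul_of_nonneg_left hs hδ]
  calc ∑ k ∈ univ.filter (fun k => pκ k = y), |f (EuclideanSpace.single k (1 : ℝ)) i - f (EuclideanSpace.single k (1 : ℝ)) i'|
      ≤ ∑ k ∈ univ.filter (fun k => pκ k = y), (|f (EuclideanSpace.single k (1 : ℝ)) i| + |f (EuclideanSpace.single k (1 : ℝ)) i'|) :=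
        Finset.sum_le_sum fun k _ => abs_sub _ _
    _ ≤ C * Real.exp (-(δ * ρ (pι i) y)) + C * Real.exp (-(δ * ρ (pι i') y)) := by
        rw [Finset.sum_add_distrib]; exact add_le_add (hf i y) (hf i' y)
    _ ≤ C * Real.exp (-(δ * ρ (pι i) y)) + C * (Real.exp (δ * s) * Real.exp (-(δ * ρ (pι i) y))) :=
        add_le_add le_rfl (mul_le_mul_of_nonneg_left hshift hC)
    _ = _ := by ring

/-! ## §5  The printed shape of (1.111): localized pair bounds, test vectors, the cut-off product rule -/

/-- **PAIR BOUND ⇒ THE SHAPE OF (1.111)** (before the cut-off): if `f` has the pair bound `(C, δ)` at `(i, i′)` anchored at `z` (`C, δ ≥ 0`), `x` is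
supported over the points within `r` of `y′` with `|x_k| ≤ X`, and `z` is within `r` of `y`, then
`|(fx)_i − (fx)_{i′}| ≤ C·K(1)e^{(1+2δ)r}·e^{−δρ(y,y′)}·X`. [cite: Balaban1984PropagatorsI, (1.111) p.35 (shape; derivation ours)] -/
theorem pairDiff_le_of_support [Fintype Y] [DecidableEq Y] (hρ : IsPseudoDist ρ) (hK : SumBound ρ KY) (f : EuclideanSpace ℝ κ →ₗ[ℝ] EuclideanSpace ℝ ι)
    (pκ : κ → Y) (i i' : ι) (z : Y) {C δ r X : ℝ} (hC : 0 ≤ C) (hδ : 0 ≤ δ) (hX : 0 ≤ X)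
    (hf : ∀ y : Y, ∑ k ∈ univ.filter (fun k => pκ k = y),
      |f (EuclideanSpace.single k (1 : ℝ)) i - f (EuclideanSpace.single k (1 : ℝ)) i'| ≤ C * Real.exp (-(δ * ρ z y)))
    (x : EuclideanSpace ℝ κ) (y y' : Y) (hsupp : ∀ k, x k ≠ 0 → ρ (pκ k) y' ≤ r) (hx : ∀ k, |x k| ≤ X) (hz : ρ z y ≤ r) :
    |f x i - f x i'| ≤ C * (KY 1 * Real.exp ((1 + 2 * δ) * r)) * Real.exp (-(δ * ρ y y')) * X := by
  rw [pairDiff_eq_sum]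
  exact abs_sum_mul_le_of_support hρ hK _ pκ z hC hδ hX hf x y y' hsupp hx hz

/-- **THE SHAPE ⇒ PAIR BOUND** (test vectors): if `|(fx)_i − (fx)_{i′}| ≤ B` for all `x` supported in the fibre of `y′` with `|x_k| ≤ 1`, then
`Σ_{k : pκ k = y′}|f(e_k)_i − f(e_k)_{i′}| ≤ B`. [cite: Balaban1984PropagatorsI, (1.111) p.35 (shape; derivation ours)] -/
theorem holderBound_of_cubeSup [DecidableEq Y] (f : EuclideanSpace ℝ κ →ₗ[ℝ] EuclideanSpace ℝ ι) (pκ : κ → Y) (i i' : ι) (y' : Y) {B : ℝ}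
    (h : ∀ x : EuclideanSpace ℝ κ, (∀ k, x k ≠ 0 → pκ k = y') → (∀ k, |x k| ≤ 1) → |f x i - f x i'| ≤ B) :
    ∑ k ∈ univ.filter (fun k => pκ k = y'), |f (EuclideanSpace.single k (1 : ℝ)) i - f (EuclideanSpace.single k (1 : ℝ)) i'| ≤ B :=
  fiberSum_abs_le_of_test _ pκ y' fun x hs hx => by rw [← pairDiff_eq_sum]; exact h x hs hx

/-- **THE CUT-OFF PRODUCT RULE OF (1.111)**: `|ζ(x)F(x) − ζ(x′)F(x′)| ≤ |ζ(x) − ζ(x′)|·|F(x)| + |ζ(x′)|·|F(x) − F(x′)|`; so a sup bound `|F(x)| ≤ S`,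
a pair (Hölder) bound `|F(x) − F(x′)| ≤ H`, `|ζ(x) − ζ(x′)| ≤ Z_h·w` (`w` = the weight `|x − x′|^α`) and `|ζ(x′)| ≤ Z₀` give
`|ζ(x)F(x) − ζ(x′)F(x′)| ≤ Z_h·w·S + Z₀·H` — the right side `(‖ζ‖_α + |ζ|)·(…)` of (1.111). [cite: Balaban1984PropagatorsI, (1.111) p.35 (the cut-off ζ ∈ C₀^∞(Δ̃(y)); product rule ours)] -/
theorem abs_cutoff_pairDiff_le {ζx ζx' Fx Fx' S H Zh w Z0 : ℝ} (hS : |Fx| ≤ S) (hH : |Fx - Fx'| ≤ H) (hζh : |ζx - ζx'| ≤ Zh * w)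
    (hζ0 : |ζx'| ≤ Z0) : |ζx * Fx - ζx' * Fx'| ≤ Zh * w * S + Z0 * H := by
  have hw : 0 ≤ Zh * w := (abs_nonneg _).trans hζh
  have e : ζx * Fx - ζx' * Fx' = (ζx - ζx') * Fx + ζx' * (Fx - Fx') := by ring
  rw [e]
  calc |(ζx - ζx') * Fx + ζx' * (Fx - Fx')| ≤ |(ζx - ζx') * Fx| + |ζx' * (Fx - Fx')| := abs_add_le _ _
    _ = |ζx - ζx'| * |Fx| + |ζx'| * |Fx - Fx'| := by rw [abs_mul, abs_mul]
    _ ≤ Zh * w * S + Z0 * H :=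
        add_le_add (mul_le_mul hζh hS (abs_nonneg _) hw) (mul_le_mul hζ0 hH (abs_nonneg _) ((abs_nonneg _).trans hζ0))

/-! ## §6  A Lipschitz quotient dominates the Hölder quotients at distance `≤ 1` -/

/-- `t ≤ t^α` for `0 ≤ t ≤ 1` and `α ≤ 1`: at distances `|x − x′| ≤ 1` a bound by `|x − x′|` implies the bound by `|x − x′|^α` of (1.109).
[cite: Balaban1984PropagatorsI, (1.109) p.35 (elementary; ours)] -/
theorem self_le_rpow_of_le_one' {t α : ℝ} (ht0 : 0 ≤ t) (ht1 : t ≤ 1) (hα : α ≤ 1) : t ≤ t ^ α := by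
  rcases ht0.eq_or_lt with h | h
  · rw [← h]
    exact Real.rpow_nonneg le_rfl α
  · calc t = t ^ (1 : ℝ) := (Real.rpow_one t).symm
      _ ≤ t ^ α := Real.rpow_le_rpow_of_exponent_ge h ht1 hα

end Abstract

end Literature.MathematicalPhysics.QuantumFieldTheory.Balaban1983to89.B6BlockHolderCalculus

end
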